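import Summits.MatrixMultiplication.OmegaCensus.STPPHamidouneRodsethThreeRuns

/-!
# ω-census (abelian STPP census): Hamidoune–Rødseth for three-element sets — the normalised theorem for at most two runs (kernel)

HONEST FRAMING (pub-omega census; verbatim): lottery ticket; floor = certified bounds/negative ranges.
Census STRUCTURE / KERNEL desk (seat pub-omega-stpp-2 gen 24, 2026-08-28), family (b2).  Third file of the UNCONDITIONAL proof of
`HamidouneRodsethCard 3` (`STPPVosperSlackOneLawCard.lean`).  Nothing here is progress on `ω`.

Normalised setting: `S = {0, 1, v} ⊆ ℤ/pℤ` (`v ≠ 0, 1`), `|T| ≥ 4`, `|T| + 7 ≤ p`, `|S + T| = |T| + 3`, and `T` has at most TWO maximal runs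
along `+1` (`|(1 + T) ∖ T| ≤ 2`).  `hr3_of_runs_le_two`: then `S` lies in a 4-term and `T` in a `(|T|+1)`-term arithmetic progression with a
common difference.  One run (`hr3_of_runs_le_one`): `T` is a progression and Hamidoune–Rødseth's Lemma 1 (tree:
`Isoperimetric.subset_apFinset_of_isAP_of_card_add_le`) finishes with difference `1`.  Two runs: `two_runs_val` (previous file) puts `T` in the
value pattern `[0,ℓ₁) ∪ [ℓ₁+g₁, ℓ₁+g₁+ℓ₂)`; `|S + T| = |T| + 3` says exactly one point of `T` leaves `U = T ∪ (T+1)` under `+v`; the arithmetic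
lemma `HR3.two_run_shape` names the family, and the progressions are exhibited (difference `1` when a gap has size one, `2⁻¹` for the
antipodal families).

References: Y. O. Hamidoune, Ø. J. Rødseth, *An inverse theorem mod p*, Acta Arith. 92 (2000) 251–262 (the theorem, case `|A| = 3`);
O. Serra, G. Zémor, Integers 0 (2000) A10, Thm 3; M. B. Nathanson, GTM 165, §2.5.
-/

open Finset
open scoped Pointwise

namespace Summit.MatrixMultiplication.OmegaCensus.HR3

open Literature.Combinatorics.Additive
open Literature.Combinatorics.Additive.Isoperimetric

variable {p : ℕ} [hp : Fact p.Prime]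

/-! ## The normalised theorem for at most two runs -/

/-- **One run.**  If `T` is a single progression along `+1` (`|(1+T)∖T| ≤ 1`), `|T| ≥ 3`, and `|{0,1,v} + T| ≤ |T| + 3 < p`, then `{0,1,v}`
lies in a 4-term and `T` in a `(|T|+1)`-term progression of difference `1` — Hamidoune–Rødseth's Lemma 1 (tree).
[cite: HamidouneRodseth2000, §2 Lemma 1] -/
theorem hr3_of_runs_le_one {v : ZMod p} (hv0 : v ≠ 0) (hv1 : v ≠ 1) {T : Finset (ZMod p)} (hT3 : 3 ≤ #T) (hTp : #T < p)
    (hr : #(((1 : ZMod p) +ᵥ T) \ T) ≤ 1) (hsum : #(({0, 1, v} : Finset (ZMod p)) + T) ≤ #T + 3)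
    (hsp : #(({0, 1, v} : Finset (ZMod p)) + T) < p) :
    ∃ d s t : ZMod p, ({0, 1, v} : Finset (ZMod p)) ⊆ apFinset s d 4 ∧ T ⊆ apFinset t d (#T + 1) := by
  classical
  have hTu : T ≠ univ := by
    intro h; rw [h, card_univ, ZMod.card] at hTp; exact lt_irrefl _ hTp
  obtain ⟨s, hTs, -⟩ := exists_eq_apFinset_of_card_vadd_sdiff_le_one one_ne_zero hTu hr
  have hAP : IsAP T (1 : ZMod p) := ⟨s, hTs⟩
  have hS3 := card_triple hv0 hv1
  obtain ⟨a, ha⟩ := subset_apFinset_of_isAP_of_card_add_le (A := ({0, 1, v} : Finset (ZMod p))) one_ne_zero hAP hT3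
    ⟨0, by simp⟩ (by rw [hS3]; omega) hsp
  rw [hS3] at ha
  exact ⟨1, a, s, ha, hTs.le.trans (apFinset_mono s 1 (by omega))⟩

/-- **At most two runs (normalised Hamidoune–Rødseth, `|S| = 3`).**  `S = {0, 1, v}` (`v ≠ 0, 1`), `|T| ≥ 4`, `|T| + 7 ≤ p`,
`|S + T| = |T| + 3` and `|(1 + T) ∖ T| ≤ 2` ⇒ `S` lies in a 4-term and `T` in a `(|T|+1)`-term progression with a common difference
(`1` or `2⁻¹`).  [cite: HamidouneRodseth2000, main theorem (§1, p. 252), case |A| = 3] -/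
theorem hr3_of_runs_le_two {v : ZMod p} (hv0 : v ≠ 0) (hv1 : v ≠ 1) {T : Finset (ZMod p)} (hT4 : 4 ≤ #T) (hTp : #T + 7 ≤ p)
    (hr : #(((1 : ZMod p) +ᵥ T) \ T) ≤ 2) (hsum : #(({0, 1, v} : Finset (ZMod p)) + T) = #T + 3) :
    ∃ d s t : ZMod p, ({0, 1, v} : Finset (ZMod p)) ⊆ apFinset s d 4 ∧ T ⊆ apFinset t d (#T + 1) := by
  classical
  by_cases hr1 : #(((1 : ZMod p) +ᵥ T) \ T) ≤ 1
  · exact hr3_of_runs_le_one hv0 hv1 (by omega) (by omega) hr1 hsum.le (by omega)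
  have hr2 : #(((1 : ZMod p) +ᵥ T) \ T) = 2 := by omega
  obtain ⟨a, ℓ₁, g₁, ℓ₂, g₂, hℓ₁, hℓ₂, hg₁, hg₂, hp', hL, hmem⟩ := two_runs_val hr2 (by omega)
  have hodd : p % 2 = 1 := by
    rcases hp.out.eq_two_or_odd with h | h
    · omega
    · exact h
  -- the shift value
  set w := v.val with hw
  have hwp : w < p := ZMod.val_lt v
  have hvw : v = (w : ZMod p) := by rw [hw, ZMod.natCast_zmod_val]
  have hw2 : 2 ≤ w := by
    have h0 : w ≠ 0 := fun h => hv0 (by rw [hvw, h, Nat.cast_zero])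
    have h1 : w ≠ 1 := fun h => hv1 (by rw [hvw, h, Nat.cast_one])
    omega
  -- `U = T ∪ (1 + T)` and the unique point of `v + T` outside `U`
  set U := T ∪ ((1 : ZMod p) +ᵥ T) with hU
  have hUcard : #U = #T + 2 := by
    have := card_sdiff_add_card ((1 : ZMod p) +ᵥ T) T
    rw [union_comm] at this; rw [hU]; omega
  have hST : ({0, 1, v} : Finset (ZMod p)) + T = U ∪ (v +ᵥ T) := triple_add_eq v T
  have hout : #((v +ᵥ T) \ U) = 1 := by
    have := card_sdiff_add_card (v +ᵥ T) U
    rw [union_comm, ← hST, hsum, hUcard] at this; omega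
  obtain ⟨y₀, hy₀⟩ := card_eq_one.1 hout
  have hmemU := mem_U_iff hℓ₁ hℓ₂ hp' hmem
  -- points of `T` from values
  have hpt : ∀ n, InT ℓ₁ g₁ ℓ₂ n → a + (n : ZMod p) ∈ T ∧ n < p := by
    intro n hn
    have hnp : n < p := by unfold InT at hn; omega
    exact ⟨(hmem _).2 (by rwa [val_add_natCast_sub a hnp]), hnp⟩
  have hbad : ∀ n, n < p → (Bad p ℓ₁ g₁ ℓ₂ w n ↔ a + (n : ZMod p) + v ∉ U) := by
    intro n hnp
    unfold Bad
    rw [hmemU, val_shift a v hnp]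
  have H : Hyp p ℓ₁ g₁ ℓ₂ g₂ w := by
    refine ⟨hℓ₁, hℓ₂, hg₁, hg₂, hp', by omega, by omega, hw2, hwp, ?_, ?_⟩
    · intro n n' hn hn' hb hb'
      obtain ⟨hx, hnp⟩ := hpt n hn
      obtain ⟨hx', hnp'⟩ := hpt n' hn'
      have h1 : v + (a + (n : ZMod p)) ∈ (v +ᵥ T) \ U :=
        mem_sdiff.2 ⟨mem_vadd_finset.2 ⟨_, hx, rfl⟩, by rw [add_comm]; exact (hbad n hnp).1 hb⟩
      have h2 : v + (a + (n' : ZMod p)) ∈ (v +ᵥ T) \ U :=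
        mem_sdiff.2 ⟨mem_vadd_finset.2 ⟨_, hx', rfl⟩, by rw [add_comm]; exact (hbad n' hnp').1 hb'⟩
      rw [hy₀, mem_singleton] at h1 h2
      have : (n : ZMod p) = n' := by
        have := h1.trans h2.symm
        simpa using this
      have hmod := (ZMod.natCast_eq_natCast_iff' n n' p).1 this
      rwa [Nat.mod_eq_of_lt hnp, Nat.mod_eq_of_lt hnp'] at hmod
    · have hy : y₀ ∈ (v +ᵥ T) \ U := by rw [hy₀]; exact mem_singleton_self _
      rw [mem_sdiff, mem_vadd_finset] at hy
      obtain ⟨⟨x, hx, rfl⟩, hxU⟩ := hy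
      refine ⟨(x - a).val, (hmem x).1 hx, ?_⟩
      rw [hbad _ (ZMod.val_lt _), ← eq_add_val_sub x a, add_comm]
      exact hxU
  -- values of the points of `T`
  have hval : ∀ x ∈ T, InT ℓ₁ g₁ ℓ₂ (x - a).val := fun x hx => (hmem x).1 hx
  have hx_eq : ∀ x : ZMod p, x = a + (((x - a).val : ℕ) : ZMod p) := fun x => eq_add_val_sub x a
  have hp0 : ((p : ℕ) : ZMod p) = 0 := ZMod.natCast_self p
  rcases two_run_shape H hodd with ⟨hgap, hvv⟩ | ⟨hvv, hbounds⟩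
  · -- a gap of size one: difference `1`
    refine ⟨1, if w ≤ 3 then 0 else v, if g₁ = 1 then a else a + ((ℓ₁ + g₁ : ℕ) : ZMod p), ?_, ?_⟩
    · intro z hz
      simp only [mem_insert, mem_singleton] at hz
      rcases hvv with h2 | h3 | hm2 | hm1
      · rw [if_pos (by omega)]
        rcases hz with rfl | rfl | rfl
        · exact mem_apFinset_of_eq (i := 0) (by omega) (by simp)
        · exact mem_apFinset_of_eq (i := 1) (by omega) (by simp)
        · exact mem_apFinset_of_eq (i := 2) (by omega) (by rw [hvw, h2]; simp)
      · rw [if_pos (by omega)]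
        rcases hz with rfl | rfl | rfl
        · exact mem_apFinset_of_eq (i := 0) (by omega) (by simp)
        · exact mem_apFinset_of_eq (i := 1) (by omega) (by simp)
        · exact mem_apFinset_of_eq (i := 3) (by omega) (by rw [hvw, h3]; simp)
      · rw [if_neg (by omega)]
        have hc : (w : ZMod p) + 2 = 0 := by
          have := congrArg (Nat.cast : ℕ → ZMod p) hm2
          push_cast at this; rw [hp0] at this; exact this
        rcases hz with rfl | rfl | rfl
        · exact mem_apFinset_of_eq (i := 2) (by omega) (by rw [hvw]; push_cast; linear_combination hc)
        · exact mem_apFinset_of_eq (i := 3) (by omega) (by rw [hvw]; push_cast; linear_combination hc)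
        · exact mem_apFinset_of_eq (i := 0) (by omega) (by simp)
      · rw [if_neg (by omega)]
        have hc : (w : ZMod p) + 1 = 0 := by
          have := congrArg (Nat.cast : ℕ → ZMod p) hm1
          push_cast at this; rw [hp0] at this; exact this
        rcases hz with rfl | rfl | rfl
        · exact mem_apFinset_of_eq (i := 1) (by omega) (by rw [hvw]; push_cast; linear_combination hc)
        · exact mem_apFinset_of_eq (i := 2) (by omega) (by rw [hvw]; push_cast; linear_combination hc)
        · exact mem_apFinset_of_eq (i := 0) (by omega) (by simp)
    · intro x hx
      have hk := hval x hx
      unfold InT at hk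
      have hxk : (((x - a).val : ℕ) : ZMod p) = x - a := ZMod.natCast_zmod_val _
      rcases hgap with hg | hg
      · rw [if_pos hg]
        exact mem_apFinset_of_eq (i := (x - a).val) (by omega) (by linear_combination hxk)
      · rw [if_neg (by omega)]
        by_cases hk1 : (x - a).val < ℓ₁
        · refine mem_apFinset_of_eq (i := (x - a).val + ℓ₂ + 1) (by omega) ?_
          have hnat : (ℓ₁ + g₁) + ((x - a).val + ℓ₂ + 1) = (x - a).val + p := by omega
          have hc := congrArg (Nat.cast : ℕ → ZMod p) hnat
          push_cast at hc ⊢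
          linear_combination hc + hxk + hp0
        · refine mem_apFinset_of_eq (i := (x - a).val - (ℓ₁ + g₁)) (by omega) ?_
          have hnat : (ℓ₁ + g₁) + ((x - a).val - (ℓ₁ + g₁)) = (x - a).val := by omega
          have hc := congrArg (Nat.cast : ℕ → ZMod p) hnat
          push_cast at hc ⊢
          linear_combination hc + hxk
  · -- the antipodal families: difference `h = 2⁻¹`
    set h : ZMod p := (2 : ZMod p)⁻¹ with hh
    have h2 : (2 : ZMod p) * h = 1 := two_mul_inv_two hodd
    refine ⟨h, if 2 * w + 1 = p then -h else 0,
      if p ≤ 2 * (ℓ₁ + g₁) then a else a - ((p - 2 * (ℓ₁ + g₁) : ℕ) : ZMod p) * h, ?_, ?_⟩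
    · intro z hz
      simp only [mem_insert, mem_singleton] at hz
      rcases hvv with hm1 | hp1 | hp3
      · rw [if_pos hm1]
        have hv' : v = -h := by
          have := congrArg (Nat.cast : ℕ → ZMod p) hm1
          push_cast at this; rw [hp0] at this
          rw [hvw]; linear_combination h * this - (w : ZMod p) * h2
        rcases hz with rfl | rfl | rfl
        · exact mem_apFinset_of_eq (i := 1) (by omega) (by push_cast; ring)
        · exact mem_apFinset_of_eq (i := 3) (by omega) (by push_cast; linear_combination h2)
        · exact mem_apFinset_of_eq (i := 0) (by omega) (by rw [hv']; push_cast; ring)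
      · rw [if_neg (by omega)]
        have hv' : v = h := by
          have := congrArg (Nat.cast : ℕ → ZMod p) hp1
          push_cast at this; rw [hp0, zero_add] at this
          rw [hvw]; linear_combination h * this - (w : ZMod p) * h2
        rcases hz with rfl | rfl | rfl
        · exact mem_apFinset_of_eq (i := 0) (by omega) (by push_cast; ring)
        · exact mem_apFinset_of_eq (i := 2) (by omega) (by push_cast; linear_combination h2)
        · exact mem_apFinset_of_eq (i := 1) (by omega) (by rw [hv']; push_cast; ring)
      · rw [if_neg (by omega)]
        have hv' : v = 3 * h := by
          have := congrArg (Nat.cast : ℕ → ZMod p) hp3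
          push_cast at this; rw [hp0, zero_add] at this
          rw [hvw]; linear_combination h * this - (w : ZMod p) * h2
        rcases hz with rfl | rfl | rfl
        · exact mem_apFinset_of_eq (i := 0) (by omega) (by push_cast; ring)
        · exact mem_apFinset_of_eq (i := 2) (by omega) (by push_cast; linear_combination h2)
        · exact mem_apFinset_of_eq (i := 3) (by omega) (by rw [hv']; push_cast; ring)
    · intro x hx
      have hk := hval x hx
      unfold InT at hk
      have hxk : (((x - a).val : ℕ) : ZMod p) = x - a := ZMod.natCast_zmod_val _
      rcases hbounds with ⟨hA, hb1, hb2⟩ | ⟨hA, hb1, hb2⟩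
      · rw [if_pos hA]
        rcases hk with hk | ⟨hk1, hk2⟩
        · refine mem_apFinset_of_eq (i := 2 * (x - a).val) (by omega) ?_
          push_cast
          linear_combination (((x - a).val : ℕ) : ZMod p) * h2 + hxk
        · refine mem_apFinset_of_eq (i := 2 * (x - a).val - p) (by omega) ?_
          have hnat : (2 * (x - a).val - p) + p = 2 * (x - a).val := by omega
          have hc := congrArg (Nat.cast : ℕ → ZMod p) hnat
          push_cast at hc ⊢
          linear_combination h * hc + (((x - a).val : ℕ) : ZMod p) * h2 + hxk - h * hp0
      · rw [if_neg (by omega)]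
        have hnat0 : (p - 2 * (ℓ₁ + g₁)) + 2 * (ℓ₁ + g₁) = p := by omega
        have hc0 := congrArg (Nat.cast : ℕ → ZMod p) hnat0
        push_cast at hc0
        rcases hk with hk | ⟨hk1, hk2⟩
        · refine mem_apFinset_of_eq (i := p - 2 * (ℓ₁ + g₁) + 2 * (x - a).val) (by omega) ?_
          push_cast
          linear_combination (((x - a).val : ℕ) : ZMod p) * h2 + hxk
        · refine mem_apFinset_of_eq (i := 2 * ((x - a).val - (ℓ₁ + g₁))) (by omega) ?_
          have hnat : 2 * ((x - a).val - (ℓ₁ + g₁)) + 2 * (ℓ₁ + g₁) = 2 * (x - a).val := by omega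
          have hc := congrArg (Nat.cast : ℕ → ZMod p) hnat
          push_cast at hc ⊢
          linear_combination h * hc + (((x - a).val : ℕ) : ZMod p) * h2 + hxk - h * hc0 - h * hp0

end Summit.MatrixMultiplication.OmegaCensus.HR3
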